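import Literature.MathematicalPhysics.QuantumFieldTheory.Chatterjee2019LargeN.LoopOperations
import Literature.MathematicalPhysics.QuantumFieldTheory.LatticeGaugeDobrushin
import HarnessLib

/-!
# Chatterjee 2019, Lemma 10.1 (the Catalan bound on the strong-coupling coefficients — `CoeffCatalanBound` DISCHARGED) and Theorem 11.1 (absolute convergence of the sum over trajectories, PROVED)

S. Chatterjee, *Rigorous solution of strongly coupled `SO(N)` lattice gauge theory in the large `N` limit*,
Comm. Math. Phys. **366** (2019) 203–268 (arXiv:1502.07719), **§10, Lemma 10.1**: «There is a constant `K(d)` such that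
if `s` is a loop sequence and `δ = (δ₁, …, δₙ)` is its degree vector, then `|a_k(s)| ≤ K(d)^{5k+ι(δ)} C_{δ₁−1} ⋯ C_{δₙ−1}`,
where `Cᵢ` is the `i`-th Catalan number.»  Held text: `paper:arxiv-1502.07719`, chunks `p0027` (Lemma 10.1 and its
proof), `p0029` (§11, Lemma 11.2: «The following lemma gives an analog of Lemma 10.1 for `b_k(s)` … We will prove the
claim by the same nested induction»).

THEOREMS ONLY; the named fact `CoeffCatalanBound` of `Chatterjee2019LargeN.MasterLoopEquation` is discharged:
★ `CoeffCatalanBound_holds : ∀ d, CoeffCatalanBound d` (net Literature debt `−1`), with the explicit constant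
`K(d) = 2 + 1024(d−1)`; and, from the same bound, HYPOTHESIS-FREE: ★ `trajectoryWeight_summable` = **Theorem 11.1**
(«if `|β| ≤ β₂(d)`, then for any non-null loop sequence `s`, `∑_{X∈𝒳(s)} |w_β(X)| < ∞`» — the absolute-convergence
conjunct of Theorem 3.1 / `GaugeStringDuality`, here with `β₂ = 1/(2K⁵)`), and `coeffA_mul_pow_summable_abs` = the first
step of the proof of **Theorem 10.3** («if `|β| < K^{−5}`, the series `∑ a_k(s) β^k` converges absolutely for any `s`»).

## The printed proof and how it is followed

In print `a_k(s)` is DEFINED by the marked-edge recursion of §10 and Lemma 10.1 is proved by «nested induction: having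
proved the bound for all `i < k` and all `s`, prove it for `a_k(s)` by induction over `ι(s)`», bounding the splitting
terms through Lemmas 9.3/9.5 and the Catalan recursion `C_{i+1} = ∑ⱼ Cⱼ C_{i−j}` ((cc1)–(cc2)), and the deformation terms
through Lemma 9.6, the monotonicity of `C` and `C_{i+1} ≤ 4Cᵢ` ((cc3)).  The tree's `a_k(s)` is the trajectory sum
`coeffA s k = ∑_{X∈𝒳ₖ(s)} v(X)` of Corollary 3.5 (sibling `StrongCoupling`), for which the tree has the SYMMETRIZED
first-move recursion (Corollary 10.4, `SymmetrizedCoeffRecursion_holds`).  The source itself runs the identical nested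
induction on a symmetrized recursion in §11 (the numbers `b_k(s)`, Lemma 11.2); accordingly we prove the bound for the
absolute trajectory sums `c_k(s) := ∑_{X∈𝒳ₖ(s)} |v(X)| ≥ |a_k(s)|` (`absCoeff`), which satisfy the first-move inequality
`c_k(s) ≤ |s|⁻¹ (∑_{𝕊(s)} c_k(s') + 𝟙[k≥1] ∑_{𝔻(s)} c_{k−1}(s'))` (`absCoeff_le_rec`; the decomposition
`FirstMove.consEquiv` is the `k`-uniform form of the sibling's `Trajectory.consEquiv`, with empty deformation fibres at
`k = 0`).  Steps:
* §A Catalan facts: monotonicity, `C_{i+1} ≤ 4Cᵢ` (from `(i+2)C_{i+1} = 2(2i+1)Cᵢ`, Mathlib's central binomial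
  identities), and the recursion in gap form `∑_{1≤g<n} C_{n−g−1} C_{g−1} ≤ C_{n−1}` (`sum_Ico_catalan_le`).
* §B the Catalan product `Π(s) = ∏ C_{|lᵢ|−1}` and its behaviour under `replaceAt` (null pieces contribute `C₀ = 1`).
* §D per move: a splitting of component `i` at cyclic gap `g` gives `Π(s') ≤ C_{nᵢ−g−1}C_{g−1} Π(others)` (tree lemmas
  `Word.length_posSplit₁_le`, …, i.e. Lemmas 9.3/9.5 in inequality form) and `ι(s') < ι(s)` (tree, Lemma 9.8); a
  deformation gives `Π(s') ≤ 4⁴ Π(s)` and `ι(s') ≤ ι(s) + 4` (`index_replaceAt_one_le_four`, the sharp form of the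
  sibling's `index_replaceAt_one_le`).
* §E the sums over the index types `𝕊⁺(s)`, `𝕊⁻(s)`, `𝔻(s)` component by component, second location reindexed by the
  gap (`sum_gap_le`; the printed «`≤ (2/m) ∑_{x∈A₁} ∑_r …`», here with factor `1` as the gap is oriented), and
  `|𝒫⁺(e)| ≤ 2(d−1)`.
* §F the nested induction `absCoeff_le_pow`: `c_k(s) ≤ K^{5k+ι(s)} Π(s)`; the bracket is `(2 + 1024(d−1))K^{−1} = 1`.
  In the tree's rendering `c_k(s)|β|^k = ∑_{X∈𝒳ₖ(s)} |w_β(X)| = S_{β,k}(s)` (Lemma 11.4 is the identity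
  `w_β(X) = v(X) β^{k}`, `tsum_abs_weight_trajectoryWith`), so `absCoeff_le_pow` is Lemma 11.2 for `S_{β,k}(s)/|β|^k`.
* §G Theorem 11.1 as printed in §11: `∑_{X∈𝒳(s)} |w_β(X)| = ∑ₖ S_{β,k}(s) ≤ K^{ι(s)} Π(s) ∑ₖ (K⁵|β|)^k < ∞` for
  `|β| ≤ 1/(2K⁵)` (`𝒳ₖ(s)` finite: Lemma 11.3 = tree `finite_trajectoryWith`; regrouping by `Equiv.sigmaFiberEquiv` and
  `summable_sigma_of_nonneg`); the first step of Theorem 10.3 likewise from `|a_k(s)| ≤ c_k(s)`.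
Deviation from print, stated: the constant (`2 + 1024(d−1)` instead of «`4K^{−3} + 4K^{−1} + 1024 d K^{−1} ≤ 1`»),
immaterial for the statement (`∃ K`).

## WHAT THIS IS NOT
No statement about the marked-edge recursion (`CoeffRecursion`, Proposition 4.1), about the limit `φ_β = lim φ_{Λ_N,N,β}`
(the second conjunct of Theorem 3.1, Theorem 8.1, the rest of Theorem 10.3) or about `GaugeStringDuality` as a whole, which
stays a named fact; nothing here bears on four-dimensional Yang–Mills or a mass gap.

## References
* S. Chatterjee, Comm. Math. Phys. **366** (2019) 203–268, doi:10.1007/s00220-019-03353-3, arXiv:1502.07719 — §10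
  Lemma 10.1 (with (catalan), (catalan2), (cc1)–(cc3)) and Theorem 10.3, §11 Theorem 11.1 and Lemmas 11.2–11.4, §12 (last
  display), Lemmas 9.3, 9.5, 9.6, 9.8. [Chatterjee2019LargeN]
-/

noncomputable section

open Finset
open Literature.Probability.LatticeModels Literature.MathematicalPhysics.QuantumLattice

namespace Literature.MathematicalPhysics.QuantumFieldTheory.Chatterjee2019LargeN

variable {d : ℕ}

namespace CoeffCatalanBoundProof

/-! ### §A Catalan numbers: monotonicity, `C_{i+1} ≤ 4 C_i`, the recursion in gap form

(The three elementary lemmas `catalan_le_succ`, `catalan_mono`, `one_le_catalan` have twins over `ℕ` in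
`Summits/PneNP/GCT/Max/KYAllMArithmetic.lean`, which a Literature file may not import, and `ℝ`-cast twins in
`Literature/Analysis/FluidPDE/CompressibleEulerImplosionOriginSeries.lean`; they are re-proved here in five lines each
rather than importing a fluid-PDE module into lattice gauge theory.  Mathlib has the Catalan recursion and the
central-binomial identities used, not these inequalities.) -/

/-- `C_n ≤ C_{n+1}` (the recursion has the term `C_n C_0`). [cite: Chatterjee2019LargeN, §10 («C_i is increasing in i»)] -/
theorem catalan_le_succ (n : ℕ) : catalan n ≤ catalan (n + 1) := by
  rw [catalan_succ' n]
  have h : (n, 0) ∈ antidiagonal n := by simp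
  calc catalan n = catalan (n, 0).1 * catalan (n, 0).2 := by simp
    _ ≤ ∑ ij ∈ antidiagonal n, catalan ij.1 * catalan ij.2 :=
        Finset.single_le_sum (f := fun ij : ℕ × ℕ => catalan ij.1 * catalan ij.2) (fun _ _ => Nat.zero_le _) h

/-- `C` is monotone. [cite: Chatterjee2019LargeN, §10 («C_i is increasing in i»)] -/
theorem catalan_mono : Monotone catalan := monotone_nat_of_le_succ catalan_le_succ

/-- `1 ≤ C_n`. [cite: Chatterjee2019LargeN, §10 (Catalan numbers)] -/
theorem one_le_catalan (n : ℕ) : 1 ≤ catalan n := by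
  calc 1 = catalan 0 := catalan_zero.symm
    _ ≤ catalan n := catalan_mono (Nat.zero_le n)

/-- `C_{i+1} ≤ 4 C_i`. [cite: Chatterjee2019LargeN, §10 (inequality (catalan2))] -/
theorem catalan_succ_le_four_mul (n : ℕ) : catalan (n + 1) ≤ 4 * catalan n := by
  have e1 : (n + 1 + 1) * catalan (n + 1) = (n + 1).centralBinom := succ_mul_catalan_eq_centralBinom (n + 1)
  have e2 := Nat.succ_mul_centralBinom_succ n
  have e3 : (n + 1) * catalan n = n.centralBinom := succ_mul_catalan_eq_centralBinom n
  have h4 : (n + 1) * ((n + 2) * catalan (n + 1)) = (n + 1) * (2 * (2 * n + 1) * catalan n) := by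
    rw [show n + 2 = n + 1 + 1 from rfl, e1, e2, ← e3]; ring
  have h5 : (n + 2) * catalan (n + 1) = 2 * (2 * n + 1) * catalan n := Nat.eq_of_mul_eq_mul_left (Nat.succ_pos n) h4
  have h6 : (n + 2) * catalan (n + 1) ≤ (n + 2) * (4 * catalan n) := by rw [h5]; nlinarith [Nat.zero_le (catalan n)]
  exact Nat.le_of_mul_le_mul_left h6 (by omega)

/-- `C_{n+j} ≤ 4ʲ C_n`. [cite: Chatterjee2019LargeN, §10 (inequality (catalan2), iterated)] -/
theorem catalan_add_le (n : ℕ) : ∀ j : ℕ, catalan (n + j) ≤ 4 ^ j * catalan n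
  | 0 => by simp
  | j + 1 => by
    calc catalan (n + (j + 1)) = catalan (n + j + 1) := rfl
      _ ≤ 4 * catalan (n + j) := catalan_succ_le_four_mul _
      _ ≤ 4 * (4 ^ j * catalan n) := Nat.mul_le_mul_left 4 (catalan_add_le n j)
      _ = 4 ^ (j + 1) * catalan n := by ring

/-- The Catalan recursion in gap form: `∑_{1 ≤ g < n} C_{n−g−1} C_{g−1} ≤ C_{n−1}` (equality for `n ≥ 2`; the empty
sum for `n ≤ 1`). [cite: Chatterjee2019LargeN, §10 (identity (catalan): C_{i+1} = ∑ⱼ Cⱼ C_{i−j})] -/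
theorem sum_Ico_catalan_le (n : ℕ) :
    ∑ g ∈ Ico 1 n, catalan (n - g - 1) * catalan (g - 1) ≤ catalan (n - 1) := by
  rcases Nat.lt_or_ge n 2 with hn | hn
  · have : Ico 1 n = ∅ := by
      apply Finset.eq_empty_of_forall_notMem; intro g hg; rw [Finset.mem_Ico] at hg; omega
    rw [this, Finset.sum_empty]
    exact Nat.zero_le _
  · obtain ⟨m, rfl⟩ : ∃ m, n = m + 2 := ⟨n - 2, by omega⟩
    rw [show m + 2 - 1 = m + 1 by omega, catalan_succ' m, Nat.sum_antidiagonal_eq_sum_range_succ_mk,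
      Finset.sum_Ico_eq_sum_range, show m + 2 - 1 = m + 1 by omega]
    refine le_of_eq (Finset.sum_congr rfl fun k hk => ?_)
    rw [Finset.mem_range] at hk
    rw [show m + 2 - (1 + k) - 1 = m - k by omega, show 1 + k - 1 = k by omega, mul_comm]

/-! ### §B The Catalan product of a loop sequence -/

/-- `Π(s) = C_{δ₁−1} ⋯ C_{δₙ−1}` («interpreted as `1` when `s = ∅`»). [cite: Chatterjee2019LargeN, Lemma 10.1 (the product of Catalan numbers)] -/
def catProd (s : LoopSeq d) : ℝ := (s.map fun l => (catalan (l.length - 1) : ℝ)).prod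

/-- `Π(∅) = 1`. [cite: Chatterjee2019LargeN, Lemma 10.1] -/
@[simp] theorem catProd_nil : catProd ([] : LoopSeq d) = 1 := rfl

/-- `Π(l :: s) = C_{|l|−1} Π(s)`. [cite: Chatterjee2019LargeN, Lemma 10.1] -/
@[simp] theorem catProd_cons (l : Word d) (s : LoopSeq d) :
    catProd (l :: s) = (catalan (l.length - 1) : ℝ) * catProd s := by
  simp [catProd]

/-- `Π(s ++ t) = Π(s) Π(t)`. [cite: Chatterjee2019LargeN, Lemma 10.1] -/
theorem catProd_append (s t : LoopSeq d) : catProd (s ++ t) = catProd s * catProd t := by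
  simp [catProd, List.map_append, List.prod_append]

/-- `1 ≤ Π(s)`. [cite: Chatterjee2019LargeN, Lemma 10.1] -/
theorem one_le_catProd : ∀ s : LoopSeq d, 1 ≤ catProd s
  | [] => le_rfl
  | l :: s => by
    rw [catProd_cons]
    have h1 : (1 : ℝ) ≤ catalan (l.length - 1) := by exact_mod_cast one_le_catalan _
    nlinarith [one_le_catProd s]

/-- `0 ≤ Π(s)`. [cite: Chatterjee2019LargeN, Lemma 10.1] -/
theorem catProd_nonneg (s : LoopSeq d) : 0 ≤ catProd s := zero_le_one.trans (one_le_catProd s)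

/-- Deleting null loops does not change `Π` (a null loop contributes `C_{0−1} = C_0 = 1`).
[cite: Chatterjee2019LargeN, Lemma 10.1] -/
theorem catProd_prune : ∀ s : LoopSeq d, catProd (LoopSeq.prune s) = catProd s
  | [] => rfl
  | l :: s => by
    by_cases h : l = []
    · subst h
      have : LoopSeq.prune (([] : Word d) :: s) = LoopSeq.prune s := by simp [LoopSeq.prune]
      rw [this, catProd_prune s, catProd_cons]
      simp
    · have : LoopSeq.prune (l :: s) = l :: LoopSeq.prune s := by simp [LoopSeq.prune, h]
      rw [this, catProd_cons, catProd_cons, catProd_prune s]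

/-- `Π(replaceAt i ws) = Π(take i) Π(ws) Π(drop (i+1))` for a loop sequence without null components.
[cite: Chatterjee2019LargeN, Lemma 10.1 (proof: the factors C_{δ₂−1} ⋯ C_{δₙ−1} are unchanged)] -/
theorem catProd_replaceAt {s : LoopSeq d} (hs : ∀ l ∈ s, l ≠ []) (i : ℕ) (ws : List (Word d)) :
    catProd (s.replaceAt i ws) = catProd (s.take i) * catProd ws * catProd (s.drop (i + 1)) := by
  have hA : LoopSeq.prune (s.take i) = s.take i := LoopSeq.prune_eq_self fun l hl => hs l (List.mem_of_mem_take hl)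
  have hB : LoopSeq.prune (s.drop (i + 1)) = s.drop (i + 1) :=
    LoopSeq.prune_eq_self fun l hl => hs l (List.mem_of_mem_drop hl)
  rw [LoopSeq.replaceAt, LoopSeq.prune, List.filter_append, List.filter_append, ← LoopSeq.prune, ← LoopSeq.prune,
    ← LoopSeq.prune, hA, hB, catProd_append, catProd_append, catProd_prune]

/-- `Π(s) = Π(take i) C_{|lᵢ|−1} Π(drop (i+1))`. [cite: Chatterjee2019LargeN, Lemma 10.1] -/
theorem catProd_eq_take_drop (s : LoopSeq d) (i : Fin s.length) :
    catProd s = catProd (s.take i) * (catalan ((s.get i).length - 1) : ℝ) * catProd (s.drop (i + 1)) := by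
  conv_lhs => rw [show s = s.take i ++ s.get i :: s.drop (i + 1) by
    rw [List.get_eq_getElem, List.cons_getElem_drop_succ, List.take_append_drop]]
  rw [catProd_append, catProd_cons, mul_assoc]

/-! ### §C Absolute trajectory sums and the first-move decomposition -/

/-- `c_k(s) = ∑_{X ∈ 𝒳ₖ(s)} |v(X)|` — the absolute version of the coefficient `a_k(s)` (it satisfies the recursion of the
`b_k(s)` of §11 with the deformation multiplicities). [cite: Chatterjee2019LargeN, §11 (the numbers b_k(s)), Lemma 11.3] -/
def absCoeff (s : LoopSeq d) (k : ℕ) : ℝ := ∑' X : TrajectoryWith s k, |X.1.vweight|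

/-- `|a_k(s)| ≤ c_k(s)`. [cite: Chatterjee2019LargeN, §11, Lemma 11.3 («|a_k(s)| ≤ …»)] -/
theorem abs_coeffA_le_absCoeff (s : LoopSeq d) (k : ℕ) : |coeffA s k| ≤ absCoeff s k := by
  classical
  haveI : Fintype (TrajectoryWith s k) := @Fintype.ofFinite _ (finite_trajectoryWith s k)
  rw [coeffA, absCoeff, tsum_fintype, tsum_fintype]
  exact Finset.abs_sum_le_sum_abs _ _

/-- `0 ≤ c_k(s)`. [cite: Chatterjee2019LargeN, §11 («b_k(s) ≥ 0 is evident»)] -/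
theorem absCoeff_nonneg (s : LoopSeq d) (k : ℕ) : 0 ≤ absCoeff s k :=
  tsum_nonneg fun _ => abs_nonneg _

/-- `c_k(∅) = 𝟙[k = 0]`. [cite: Chatterjee2019LargeN, §11 («b₀(∅) = 1», «b_k(∅) = 0»)] -/
theorem absCoeff_nil (k : ℕ) : absCoeff ([] : LoopSeq d) k = if k = 0 then 1 else 0 := by
  rw [absCoeff]
  split_ifs with hk
  · subst hk
    rw [tsum_eq_single ⟨Trajectory.nil, rfl⟩]
    · simp [Trajectory.vweight]
    · intro X hX
      exact (hX (Subtype.ext (trajectory_nil_eq_nil X.1))).elim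
  · haveI : IsEmpty (TrajectoryWith ([] : LoopSeq d) k) :=
      ⟨fun X => by
        have h := X.2
        rw [trajectory_nil_eq_nil X.1] at h
        simp [Trajectory.numDeform] at h
        omega⟩
    exact tsum_empty

namespace FirstMove

variable {s : LoopSeq d}

/-- Reassembling the first move and the tail gives the trajectory back. [folklore] -/
private theorem cons_headTail : ∀ {s : LoopSeq d} (X : Trajectory s) (h : s ≠ []),
    Trajectory.cons (X.headTail h).1 (X.headTail h).2 = X
  | _, Trajectory.nil, h => absurd rfl h
  | _, Trajectory.cons _ _, _ => rfl

/-- `δ(X) = δ(first move) + δ(tail)`. [folklore] -/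
private theorem numDeform_headTail : ∀ {s : LoopSeq d} (X : Trajectory s) (h : s ≠ []),
    X.numDeform = (X.headTail h).1.dcount + (X.headTail h).2.numDeform
  | _, Trajectory.nil, h => absurd rfl h
  | _, Trajectory.cons _ _, _ => rfl

/-- First-move decomposition of `𝒳ₖ(s)` for non-null `s` and EVERY `k`:
`𝒳ₖ(s) ≃ Σ_{s ↝ s'} {X' ∈ 𝒳(s') : δ(s,s') + δ(X') = k}` (for `k = 0` the deformation fibres are empty).
[cite: Chatterjee2019LargeN, §11–12 («any X ∈ 𝒳ₖ(s) may either be obtained uniquely as (s, X') …»)] -/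
def consEquiv (hs : s ≠ []) (k : ℕ) :
    TrajectoryWith s k ≃ Σ m : Move s, {Y : Trajectory m.result // m.dcount + Y.numDeform = k} where
  toFun X := ⟨(X.1.headTail hs).1, ⟨(X.1.headTail hs).2, by rw [← numDeform_headTail X.1 hs]; exact X.2⟩⟩
  invFun p := ⟨Trajectory.cons p.1 p.2.1, by
    have h := p.2.2
    simp only [Trajectory.numDeform]
    unfold Move.dcount at h
    exact h⟩
  left_inv X := Subtype.ext (cons_headTail X.1 hs)
  right_inv p := by
    rcases p with ⟨m, ⟨Y, hY⟩⟩
    rfl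

end FirstMove

/-- `|v(s, s')| = 1/|s|` for every move. [cite: Chatterjee2019LargeN, §2.2 (v(s, s') = ∓1/|s|)] -/
theorem abs_vweight (s : LoopSeq d) (m : Move s) : |m.vweight| = 1 / (s.len : ℝ) := by
  cases m <;> simp [Move.vweight, abs_div]

/-- The fibre sum over `{X' : δ(s,s') + δ(X') = k}` is at most `c_{k − δ(s,s')}(s')`, and vanishes unless `δ(s,s') ≤ k`.
[cite: Chatterjee2019LargeN, §11 (recursion for b_k)] -/
theorem fibre_sum_le {s : LoopSeq d} (m : Move s) (k : ℕ)
    [Fintype {Y : Trajectory m.result // m.dcount + Y.numDeform = k}] :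
    ∑ Y : {Y : Trajectory m.result // m.dcount + Y.numDeform = k}, |Y.1.vweight| ≤
      if m.dcount ≤ k then absCoeff m.result (k - m.dcount) else 0 := by
  classical
  split_ifs with h
  · haveI : Fintype (TrajectoryWith m.result (k - m.dcount)) :=
      @Fintype.ofFinite _ (finite_trajectoryWith m.result (k - m.dcount))
    rw [absCoeff, tsum_fintype]
    let e : {Y : Trajectory m.result // m.dcount + Y.numDeform = k} ≃ TrajectoryWith m.result (k - m.dcount) :=
      Equiv.subtypeEquivRight fun Y => by constructor <;> intro hY <;> omega
    rw [← e.symm.sum_comp]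
    exact le_of_eq (Finset.sum_congr rfl fun Y _ => rfl)
  · have : IsEmpty {Y : Trajectory m.result // m.dcount + Y.numDeform = k} :=
      ⟨fun Y => h (by have := Y.2; omega)⟩
    rw [Fintype.sum_empty]

/-- **The recursive inequality for `c_k`** (first-move decomposition; the deformation terms are absent for `k = 0`):
`c_k(s) ≤ |s|⁻¹ (∑_{𝕊⁺(s)} c_k(s') + ∑_{𝕊⁻(s)} c_k(s') + 𝟙[k ≥ 1] (∑_{𝔻⁺(s)} c_{k−1}(s') + ∑_{𝔻⁻(s)} c_{k−1}(s')))`.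
[cite: Chatterjee2019LargeN, §11 (definition of b_k(s)), Lemma 11.3] -/
theorem absCoeff_le_rec {s : LoopSeq d} (hs : s ≠ []) (k : ℕ) :
    absCoeff s k ≤ (1 / (s.len : ℝ)) *
      ((∑ o : SameIdx s, absCoeff (s.posSplitAt o) k) + (∑ o : InvIdx s, absCoeff (s.negSplitAt o) k)
        + if 1 ≤ k then
            (∑ o : DeformIdx s, absCoeff (s.posDeformAt o) (k - 1)) + ∑ o : DeformIdx s, absCoeff (s.negDeformAt o) (k - 1)
          else 0) := by
  classical
  haveI : Fintype (TrajectoryWith s k) := @Fintype.ofFinite _ (finite_trajectoryWith s k)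
  letI : Fintype (Move s) := Fintype.ofEquiv _ (Move.equivSum (s := s)).symm
  haveI hfib : ∀ m : Move s, Fintype {Y : Trajectory m.result // m.dcount + Y.numDeform = k} := fun m => by
    haveI := finite_trajectoryWith m.result (k - m.dcount)
    exact @Fintype.ofFinite _ (Finite.of_injective
      (fun Y : {Y : Trajectory m.result // m.dcount + Y.numDeform = k} =>
        (⟨Y.1, by have := Y.2; omega⟩ : TrajectoryWith m.result (k - m.dcount)))
      (by
        rintro ⟨Y, hY⟩ ⟨Y', hY'⟩ h
        simp only [Subtype.mk.injEq] at h
        subst h; rfl))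
  -- first-move decomposition
  have h1 : absCoeff s k = ∑ m : Move s, |m.vweight| *
      ∑ Y : {Y : Trajectory m.result // m.dcount + Y.numDeform = k}, |Y.1.vweight| := by
    rw [absCoeff, tsum_fintype, ← (FirstMove.consEquiv hs k).symm.sum_comp, Fintype.sum_sigma]
    refine Finset.sum_congr rfl fun m _ => ?_
    rw [Finset.mul_sum]
    refine Finset.sum_congr rfl fun Y _ => ?_
    show |(Trajectory.cons m Y.1).vweight| = _
    rw [Trajectory.vweight, abs_mul]
  rw [h1]
  -- bound each fibre and pull out `1/|s|`
  have h2 : ∑ m : Move s, |m.vweight| * ∑ Y : {Y : Trajectory m.result // m.dcount + Y.numDeform = k}, |Y.1.vweight|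
      ≤ ∑ m : Move s, (1 / (s.len : ℝ)) * (if m.dcount ≤ k then absCoeff m.result (k - m.dcount) else 0) := by
    refine Finset.sum_le_sum fun m _ => ?_
    rw [abs_vweight]
    exact mul_le_mul_of_nonneg_left (fibre_sum_le m k) (by positivity)
  refine h2.trans (le_of_eq ?_)
  rw [← Finset.mul_sum, ← (Move.equivSum (s := s)).symm.sum_comp, Fintype.sum_sum_type, Fintype.sum_sum_type,
    Fintype.sum_sum_type]
  congr 1
  by_cases hk : 1 ≤ k
  · simp only [Move.equivSum, Move.ofSum, Equiv.coe_fn_symm_mk, Move.dcount, Move.isDeform, if_true,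
      show (1 : ℕ) ≤ k ↔ True from ⟨fun _ => trivial, fun _ => hk⟩, Move.result, Bool.false_eq_true, if_false,
      zero_le, Nat.sub_zero]
    ring
  · have hk0 : k = 0 := by omega
    subst hk0
    simp only [Move.equivSum, Move.ofSum, Equiv.coe_fn_symm_mk, Move.dcount, Move.isDeform, if_true,
      Move.result, Bool.false_eq_true, if_false, Nat.sub_zero, le_refl,
      show ¬ ((1 : ℕ) ≤ 0) from Nat.not_succ_le_zero 0, Finset.sum_const_zero, zero_add]
    ring


/-! ### §D Bookkeeping along one move: Catalan products and indices of the results -/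

/-- `#` of a one-word replacement: `#s' + 1 = #s + 𝟙[w ≠ ∅]`. [cite: Chatterjee2019LargeN, Lemma 9.5 (bookkeeping of a deformation)] -/
theorem size_replaceAt_one {s : LoopSeq d} (hs : ∀ l ∈ s, l ≠ []) (i : Fin s.length) (w : Word d) :
    (s.replaceAt i [w]).size + 1 = s.size + (if w = [] then 0 else 1) := by
  have hA : LoopSeq.prune (s.take i) = s.take i :=
    LoopSeq.prune_eq_self fun l hl => hs l (List.mem_of_mem_take hl)
  have hB : LoopSeq.prune (s.drop (i + 1)) = s.drop (i + 1) :=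
    LoopSeq.prune_eq_self fun l hl => hs l (List.mem_of_mem_drop hl)
  rw [LoopSeq.replaceAt, LoopSeq.prune, List.filter_append, List.filter_append, ← LoopSeq.prune, ← LoopSeq.prune,
    ← LoopSeq.prune, hA, hB, LoopSeq.size, LoopSeq.size, List.length_append, List.length_append, List.length_take,
    List.length_drop]
  have hi := i.isLt
  by_cases hw : w = []
  · simp [LoopSeq.prune, hw]
    omega
  · simp [LoopSeq.prune, hw]

/-- **Sharp index bookkeeping of a deformation**: replacing `lᵢ` by one word of length `≤ |lᵢ| + 4` raises `ι` by at most
`4` (the printed `ι(δ') ≤ ι(δ) + 4`, resp. `ι(γ(δ))` when the word is null). [cite: Chatterjee2019LargeN, Lemma 9.6 and §9 proof of Theorem 9.2 («ι(α(δ)) = ι(δ) + 4»)] -/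
theorem index_replaceAt_one_le_four {s : LoopSeq d} (hs : ∀ l ∈ s, l ≠ []) (i : Fin s.length) (w : Word d)
    (hw : w.length ≤ (s.get i).length + 4) : (s.replaceAt i [w]).index ≤ s.index + 4 := by
  have hlen := LoopSeq.len_replaceAt s i [w]
  have hsize := size_replaceAt_one hs i w
  have h1 : s.size ≤ s.len := LoopSeq.size_le_len hs
  have h2 : (s.replaceAt i [w]).size ≤ (s.replaceAt i [w]).len :=
    LoopSeq.size_le_len (LoopSeq.ne_nil_of_mem_replaceAt s i [w])
  have h3 : 1 ≤ (s.get i).length := List.length_pos_of_ne_nil (hs _ (List.get_mem s i))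
  simp only [LoopSeq.len_cons, LoopSeq.len_nil, add_zero] at hlen
  unfold LoopSeq.index
  by_cases hw0 : w = []
  · subst hw0
    simp only [if_true, List.length_nil] at hsize hlen
    omega
  · simp only [hw0, if_false] at hsize
    omega

/-- `Π` of a positive splitting of component `i` at gap `g`: `≤ C_{nᵢ−g−1} C_{g−1} Π(rest)`.
[cite: Chatterjee2019LargeN, proof of Lemma 10.1 (bound (cc2), via Lemma 9.3)] -/
theorem catProd_posSplitAt_le {s : LoopSeq d} (hs : ∀ l ∈ s, l ≠ []) (o : SameIdx s) :
    catProd (s.posSplitAt o) ≤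
      catProd (s.take o.1) * ((catalan ((s.get o.1).length - Word.gap (s.get o.1) o.2.1.1 o.2.1.2 - 1) *
        catalan (Word.gap (s.get o.1) o.2.1.1 o.2.1.2 - 1) : ℕ) : ℝ) * catProd (s.drop (o.1 + 1)) := by
  obtain ⟨i, ⟨xy, hxy, he⟩⟩ := o
  rw [LoopSeq.posSplitAt, catProd_replaceAt hs]
  refine mul_le_mul_of_nonneg_right (mul_le_mul_of_nonneg_left ?_ (catProd_nonneg _)) (catProd_nonneg _)
  simp only [catProd_cons, catProd_nil, mul_one, Nat.cast_mul]
  have h1 := Word.length_posSplit₁_le (s.get i) xy.1 xy.2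
  have h2 := Word.length_posSplit₂_le (s.get i) hxy
  gcongr <;> exact catalan_mono (by omega)

/-- `Π` of a negative splitting of component `i` at gap `g`: `≤ C_{nᵢ−g−1} C_{g−1} Π(rest)` (even `C_{nᵢ−g−2} C_{g−2}`).
[cite: Chatterjee2019LargeN, proof of Lemma 10.1 (bound (cc1), via Lemma 9.5)] -/
theorem catProd_negSplitAt_le {s : LoopSeq d} (hs : ∀ l ∈ s, l ≠ []) (o : InvIdx s) :
    catProd (s.negSplitAt o) ≤
      catProd (s.take o.1) * ((catalan ((s.get o.1).length - Word.gap (s.get o.1) o.2.1.1 o.2.1.2 - 1) *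
        catalan (Word.gap (s.get o.1) o.2.1.1 o.2.1.2 - 1) : ℕ) : ℝ) * catProd (s.drop (o.1 + 1)) := by
  obtain ⟨i, ⟨xy, he⟩⟩ := o
  rw [LoopSeq.negSplitAt, catProd_replaceAt hs]
  refine mul_le_mul_of_nonneg_right (mul_le_mul_of_nonneg_left ?_ (catProd_nonneg _)) (catProd_nonneg _)
  simp only [catProd_cons, catProd_nil, mul_one, Nat.cast_mul]
  have h1 := Word.length_negSplit₁_le (s.get i) xy.1 xy.2
  have h2 := Word.length_negSplit₂_le (s.get i) xy.1 xy.2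
  gcongr <;> exact catalan_mono (by omega)

/-- `Π(s) = Π(take i) C_{nᵢ−1} Π(drop (i+1))`, with `∑_g C_{nᵢ−g−1} C_{g−1} ≤ C_{nᵢ−1}` this closes the splitting
bounds. [cite: Chatterjee2019LargeN, proof of Lemma 10.1 («≤ 2K^{…} C_{δ₁−1} ⋯ C_{δₙ−1}»)] -/
theorem sum_Ico_catProd_le (s : LoopSeq d) (i : Fin s.length) :
    ∑ g ∈ Ico 1 (s.get i).length,
        catProd (s.take i) * ((catalan ((s.get i).length - g - 1) * catalan (g - 1) : ℕ) : ℝ) *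
          catProd (s.drop (i + 1)) ≤ catProd s := by
  rw [← Finset.sum_mul, ← Finset.mul_sum, catProd_eq_take_drop s i]
  refine mul_le_mul_of_nonneg_right (mul_le_mul_of_nonneg_left ?_ (catProd_nonneg _)) (catProd_nonneg _)
  exact_mod_cast sum_Ico_catalan_le (s.get i).length

/-- `Π` of a deformation of component `i`: `≤ 4⁴ Π(s)` (`|lᵢ ⊕ p| ≤ |lᵢ| + 4`, `C_{n+3} ≤ 4⁴ C_{n−1}`).
[cite: Chatterjee2019LargeN, proof of Lemma 10.1 (bound (cc3), via Lemma 9.6 and (catalan2))] -/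
theorem catProd_replaceAt_one_le {s : LoopSeq d} (hs : ∀ l ∈ s, l ≠ []) (i : Fin s.length) (w : Word d)
    (hw : w.length ≤ (s.get i).length + 4) : catProd (s.replaceAt i [w]) ≤ 256 * catProd s := by
  rw [catProd_replaceAt hs, catProd_eq_take_drop s i, catProd_cons, catProd_nil, mul_one]
  have hn : 1 ≤ (s.get i).length := List.length_pos_of_ne_nil (hs _ (List.get_mem s i))
  have hc : (catalan (w.length - 1) : ℝ) ≤ 256 * catalan ((s.get i).length - 1) := by
    have h1 : catalan (w.length - 1) ≤ catalan ((s.get i).length - 1 + 4) := catalan_mono (by omega)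
    have h2 := catalan_add_le ((s.get i).length - 1) 4
    exact_mod_cast h1.trans h2
  calc catProd (s.take i) * (catalan (w.length - 1) : ℝ) * catProd (s.drop (i + 1))
      ≤ catProd (s.take i) * (256 * catalan ((s.get i).length - 1)) * catProd (s.drop (i + 1)) := by
        gcongr
        · exact catProd_nonneg _
        · exact catProd_nonneg _
    _ = 256 * (catProd (s.take i) * (catalan ((s.get i).length - 1) : ℝ) * catProd (s.drop (i + 1))) := by ring

/-! ### §E Sums over the operation index types, component by component -/

/-- Gap reindexing in one component: `∑_{y ≠ x} f(gap(x,y)) ≤ ∑_{1 ≤ g < n} f(g)` for `f ≥ 0`.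
[cite: Chatterjee2019LargeN, proof of Lemma 10.1 («≤ (2/m) ∑_{x∈A₁} ∑_{r} …»)] -/
theorem sum_gap_le (l : Word d) (x : Fin l.length) (f : ℕ → ℝ) (hf : ∀ g, 0 ≤ f g) :
    ∑ y ∈ univ.filter (fun y => x ≠ y), f (Word.gap l x y) ≤ ∑ g ∈ Ico 1 l.length, f g := by
  have hinj : ∀ y ∈ univ.filter (fun y => x ≠ y), ∀ y' ∈ univ.filter (fun y => x ≠ y),
      Word.gap l x y = Word.gap l x y' → y = y' := by
    intro y _ y' _ h
    unfold Word.gap at h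
    have hy := y.isLt
    have hy' := y'.isLt
    apply Fin.ext
    by_cases h1 : x ≤ y <;> by_cases h2 : x ≤ y'
    · rw [Fin.coe_sub_iff_le.mpr h1, Fin.coe_sub_iff_le.mpr h2] at h
      have := Fin.le_def.mp h1; have := Fin.le_def.mp h2; omega
    · rw [Fin.coe_sub_iff_le.mpr h1, Fin.coe_sub_iff_lt.mpr (lt_of_not_ge h2)] at h
      have := Fin.le_def.mp h1; have := Fin.lt_def.mp (lt_of_not_ge h2); omega
    · rw [Fin.coe_sub_iff_lt.mpr (lt_of_not_ge h1), Fin.coe_sub_iff_le.mpr h2] at h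
      have := Fin.lt_def.mp (lt_of_not_ge h1); have := Fin.le_def.mp h2; omega
    · rw [Fin.coe_sub_iff_lt.mpr (lt_of_not_ge h1), Fin.coe_sub_iff_lt.mpr (lt_of_not_ge h2)] at h
      have := Fin.lt_def.mp (lt_of_not_ge h1); have := Fin.lt_def.mp (lt_of_not_ge h2); omega
  rw [← Finset.sum_image (g := Word.gap l x) (f := f) hinj]
  refine Finset.sum_le_sum_of_subset_of_nonneg (fun k hk => ?_) (fun _ _ _ => hf _)
  rw [Finset.mem_image] at hk
  obtain ⟨y, hy, rfl⟩ := hk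
  rw [Finset.mem_filter] at hy
  rw [Finset.mem_Ico]
  exact ⟨Word.gap_pos l hy.2, Word.gap_lt l x y⟩

/-- Pairs of distinct locations in one component, reorganised by the gap:
`∑_{(x,y), x ≠ y} f(gap) ≤ n ∑_{1 ≤ g < n} f(g)`. [cite: Chatterjee2019LargeN, proof of Lemma 10.1 (the double sums over x, y)] -/
theorem sum_pairs_le (l : Word d) (f : ℕ → ℝ) (hf : ∀ g, 0 ≤ f g) :
    ∑ xy ∈ (univ : Finset (Fin l.length × Fin l.length)).filter (fun xy => xy.1 ≠ xy.2), f (Word.gap l xy.1 xy.2)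
      ≤ (l.length : ℝ) * ∑ g ∈ Ico 1 l.length, f g := by
  calc ∑ xy ∈ (univ : Finset (Fin l.length × Fin l.length)).filter (fun xy => xy.1 ≠ xy.2), f (Word.gap l xy.1 xy.2)
      = ∑ x : Fin l.length, ∑ y ∈ univ.filter (fun y => x ≠ y), f (Word.gap l x y) := by
        rw [Finset.sum_filter, ← Finset.univ_product_univ, Finset.sum_product]
        refine Finset.sum_congr rfl fun x _ => ?_
        rw [Finset.sum_filter]
    _ ≤ ∑ _x : Fin l.length, ∑ g ∈ Ico 1 l.length, f g := Finset.sum_le_sum fun x _ => sum_gap_le l x f hf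
    _ = (l.length : ℝ) * ∑ g ∈ Ico 1 l.length, f g := by
        rw [Finset.sum_const, Finset.card_univ, Fintype.card_fin, nsmul_eq_mul]

/-- **Positive splittings, summed**: if each term is bounded through the gap of its location pair by `B i g ≥ 0`, then
`∑_{o ∈ 𝕊⁺(s)} F(o) ≤ ∑ᵢ nᵢ ∑_{1 ≤ g < nᵢ} B i g`. [cite: Chatterjee2019LargeN, proof of Lemma 10.1 (bound (cc2))] -/
theorem sum_sameIdx_le {s : LoopSeq d} (F : SameIdx s → ℝ) (B : Fin s.length → ℕ → ℝ) (hB : ∀ i g, 0 ≤ B i g)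
    (hF : ∀ o : SameIdx s, F o ≤ B o.1 (Word.gap (s.get o.1) o.2.1.1 o.2.1.2)) :
    ∑ o, F o ≤ ∑ i : Fin s.length, ((s.get i).length : ℝ) * ∑ g ∈ Ico 1 (s.get i).length, B i g := by
  rw [Fintype.sum_sigma]
  refine Finset.sum_le_sum fun i _ => ?_
  calc ∑ q : {xy : Fin (s.get i).length × Fin (s.get i).length // xy.1 ≠ xy.2 ∧ (s.get i).get xy.2 = (s.get i).get xy.1},
        F ⟨i, q⟩
      ≤ ∑ q : {xy : Fin (s.get i).length × Fin (s.get i).length // xy.1 ≠ xy.2 ∧ (s.get i).get xy.2 = (s.get i).get xy.1},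
        B i (Word.gap (s.get i) q.1.1 q.1.2) := Finset.sum_le_sum fun q _ => hF ⟨i, q⟩
    _ = ∑ xy ∈ univ.filter (fun xy : Fin (s.get i).length × Fin (s.get i).length =>
          xy.1 ≠ xy.2 ∧ (s.get i).get xy.2 = (s.get i).get xy.1), B i (Word.gap (s.get i) xy.1 xy.2) := by
        symm
        apply Finset.sum_subtype
        intro xy
        simp
    _ ≤ ∑ xy ∈ univ.filter (fun xy : Fin (s.get i).length × Fin (s.get i).length => xy.1 ≠ xy.2),
          B i (Word.gap (s.get i) xy.1 xy.2) := by
        refine Finset.sum_le_sum_of_subset_of_nonneg (fun xy hxy => ?_) (fun _ _ _ => hB _ _)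
        rw [Finset.mem_filter] at hxy ⊢
        exact ⟨hxy.1, hxy.2.1⟩
    _ ≤ _ := sum_pairs_le (s.get i) (B i) (hB i)

/-- **Negative splittings, summed**: same bound. [cite: Chatterjee2019LargeN, proof of Lemma 10.1 (bound (cc1))] -/
theorem sum_invIdx_le {s : LoopSeq d} (F : InvIdx s → ℝ) (B : Fin s.length → ℕ → ℝ) (hB : ∀ i g, 0 ≤ B i g)
    (hF : ∀ o : InvIdx s, F o ≤ B o.1 (Word.gap (s.get o.1) o.2.1.1 o.2.1.2)) :
    ∑ o, F o ≤ ∑ i : Fin s.length, ((s.get i).length : ℝ) * ∑ g ∈ Ico 1 (s.get i).length, B i g := by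
  rw [Fintype.sum_sigma]
  refine Finset.sum_le_sum fun i _ => ?_
  calc ∑ q : {xy : Fin (s.get i).length × Fin (s.get i).length // (s.get i).get xy.2 = DEdge.inv ((s.get i).get xy.1)},
        F ⟨i, q⟩
      ≤ ∑ q : {xy : Fin (s.get i).length × Fin (s.get i).length // (s.get i).get xy.2 = DEdge.inv ((s.get i).get xy.1)},
        B i (Word.gap (s.get i) q.1.1 q.1.2) := Finset.sum_le_sum fun q _ => hF ⟨i, q⟩
    _ = ∑ xy ∈ univ.filter (fun xy : Fin (s.get i).length × Fin (s.get i).length =>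
          (s.get i).get xy.2 = DEdge.inv ((s.get i).get xy.1)), B i (Word.gap (s.get i) xy.1 xy.2) := by
        symm
        apply Finset.sum_subtype
        intro xy
        simp
    _ ≤ ∑ xy ∈ univ.filter (fun xy : Fin (s.get i).length × Fin (s.get i).length => xy.1 ≠ xy.2),
          B i (Word.gap (s.get i) xy.1 xy.2) := by
        refine Finset.sum_le_sum_of_subset_of_nonneg (fun xy hxy => ?_) (fun _ _ _ => hB _ _)
        rw [Finset.mem_filter] at hxy ⊢
        refine ⟨hxy.1, fun heq => ?_⟩
        have h := hxy.2
        rw [← heq] at h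
        exact DEdge.inv_ne_self _ h.symm
    _ ≤ _ := sum_pairs_le (s.get i) (B i) (hB i)

/-- **Deformations, summed**: if each term of component `i` is bounded by `B i ≥ 0`, then
`∑_{o ∈ 𝔻(s)} F(o) ≤ ∑ᵢ nᵢ · 2(d−1) · B i`. [cite: Chatterjee2019LargeN, proof of Lemma 10.1 (bound (cc3) summed over p and x)] -/
theorem sum_deformIdx_le {s : LoopSeq d} (F : DeformIdx s → ℝ) (B : Fin s.length → ℝ) (hB : ∀ i, 0 ≤ B i)
    (hF : ∀ o : DeformIdx s, F o ≤ B o.1) :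
    ∑ o, F o ≤ ∑ i : Fin s.length, ((s.get i).length : ℝ) * ((2 * (d - 1) : ℕ) : ℝ) * B i := by
  rw [Fintype.sum_sigma]
  refine Finset.sum_le_sum fun i _ => ?_
  rw [Fintype.sum_sigma]
  calc ∑ x : Fin (s.get i).length, ∑ p : ↥(plaquettesAt ((s.get i).get x)), F ⟨i, x, p⟩
      ≤ ∑ x : Fin (s.get i).length, ∑ _p : ↥(plaquettesAt ((s.get i).get x)), B i :=
        Finset.sum_le_sum fun x _ => Finset.sum_le_sum fun p _ => hF ⟨i, x, p⟩
    _ ≤ ∑ _x : Fin (s.get i).length, ((2 * (d - 1) : ℕ) : ℝ) * B i := by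
        refine Finset.sum_le_sum fun x _ => ?_
        rw [Finset.sum_const, Finset.card_univ, Fintype.card_coe, nsmul_eq_mul]
        exact mul_le_mul_of_nonneg_right
          (by exact_mod_cast (card_plaquettesTouching_singleton_le _ : (plaquettesAt _).card ≤ 2 * (d - 1)))
          (hB i)
    _ = ((s.get i).length : ℝ) * ((2 * (d - 1) : ℕ) : ℝ) * B i := by
        rw [Finset.sum_const, Finset.card_univ, Fintype.card_fin, nsmul_eq_mul, mul_assoc]

/-- `∑ᵢ nᵢ = |s|`. [cite: Chatterjee2019LargeN, §2.1 (|s| = |l₁| + ⋯ + |lₙ|)] -/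
theorem sum_length_get (s : LoopSeq d) : ∑ i : Fin s.length, ((s.get i).length : ℝ) = s.len := by
  have h : ∑ i : Fin s.length, (s.get i).length = s.len := by
    rw [Fin.sum_univ_def, LoopSeq.len]
    conv_rhs => rw [← List.map_get_finRange s, List.map_map]
    rfl
  exact_mod_cast h


/-! ### §F The nested induction (Lemma 10.1 / Lemma 11.2) -/

/-- A non-null loop has at least two edges (no self-loops in `ℤ^d`). [cite: Chatterjee2019LargeN, Lemma 9.7 («|s| ≥ 4#s»; here the weaker |l| ≥ 2)] -/
theorem one_lt_length_of_isLoop {l : Word d} (hl : IsLoop l) (hne : l ≠ []) : 1 < l.length := by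
  match l, hl, hne with
  | [], _, hne => exact (hne rfl).elim
  | [e], hl, _ =>
    exfalso
    have h := hl.1.2 (List.cons_ne_nil e [])
    simp only [List.getLast_singleton, List.head_cons] at h
    obtain ⟨⟨x, i⟩, b⟩ := e
    have h1 : (Pi.single i (1 : ℤ) : Literature.Probability.LatticeModels.Site d) ≠ 0 := by
      intro h0
      have := congr_fun h0 i
      simp at this
    cases b <;> simp [DEdge.tgt, DEdge.src, h1] at h
  | _ :: _ :: _, _, _ => simp

/-- `2 #s ≤ |s|` for a genuine loop sequence. [cite: Chatterjee2019LargeN, Lemma 9.7 («|s| ≥ 4#s»)] -/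
theorem two_mul_size_le_len : ∀ {s : LoopSeq d}, IsLoopSeq s → 2 * s.size ≤ s.len
  | [], _ => by simp [LoopSeq.size, LoopSeq.len_nil]
  | l :: s, hs => by
    have hl := hs l (by simp)
    have ih := two_mul_size_le_len (s := s) fun u hu => hs u (List.mem_cons_of_mem _ hu)
    have h2 := one_lt_length_of_isLoop hl.1 hl.2
    simp only [LoopSeq.size, List.length_cons, LoopSeq.len_cons] at ih ⊢
    omega

/-- `ι(s) ≥ 1` for a non-null genuine loop sequence («the index of any non-null loop sequence is strictly positive»).
[cite: Chatterjee2019LargeN, Lemma 9.7] -/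
theorem one_le_index {s : LoopSeq d} (hs : IsLoopSeq s) (hne : s ≠ []) : 1 ≤ s.index := by
  have h1 := two_mul_size_le_len hs
  have h2 : 1 ≤ s.size := List.length_pos_of_ne_nil hne
  unfold LoopSeq.index
  omega

/-- The constant `K(d) = 2 + 1024(d−1)` (the printed proof: «Choosing K so large that
`4K^{−3} + 4K^{−1} + 1024 d K^{−1} ≤ 1`»; with the symmetrized recursion the bracket is `(2 + 1024(d−1)) K^{−1}`).
[cite: Chatterjee2019LargeN, proof of Lemma 10.1 (choice of K)] -/
def bigK (d : ℕ) : ℝ := ((2 + 1024 * (d - 1) : ℕ) : ℝ)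

/-- `1 ≤ K(d)`. [cite: Chatterjee2019LargeN, Lemma 10.1 («K ≥ 1»)] -/
theorem one_le_bigK (d : ℕ) : 1 ≤ bigK d := by
  unfold bigK; exact_mod_cast (by omega : 1 ≤ 2 + 1024 * (d - 1))

/-- **Lemma 10.1 / 11.2 for the absolute trajectory sums**: `c_k(s) ≤ K^{5k+ι(s)} C_{δ₁−1} ⋯ C_{δₙ−1}`, by the
printed nested induction (outer on `k`, inner on `ι(s)`), run on the symmetrized absolute recursion `absCoeff_le_rec`.
[cite: Chatterjee2019LargeN, Lemma 10.1 and Lemma 11.2 (proof: nested induction with the Catalan recursion)] -/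
theorem absCoeff_le_pow (k : ℕ) : ∀ s : LoopSeq d, IsLoopSeq s →
    absCoeff s k ≤ bigK d ^ (5 * k + s.index) * catProd s := by
  induction k using Nat.strong_induction_on with
  | _ k ihk =>
  have hK1 : 1 ≤ bigK d := one_le_bigK d
  have hK0 : 0 ≤ bigK d := zero_le_one.trans hK1
  have main : ∀ n : ℕ, ∀ s : LoopSeq d, s.index = n → IsLoopSeq s →
      absCoeff s k ≤ bigK d ^ (5 * k + s.index) * catProd s := by
    intro n
    induction n using Nat.strong_induction_on with
    | _ n ihn =>
    intro s hsn hs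
    by_cases hs0 : s = []
    · subst hs0
      rw [absCoeff_nil, catProd_nil, mul_one]
      split_ifs with hk
      · subst hk; simp [LoopSeq.index_nil]
      · positivity
    -- non-null case
    have hsne : ∀ l ∈ s, l ≠ [] := fun l hl => (hs l hl).2
    have hι : 1 ≤ s.index := one_le_index hs hs0
    have hlen : (0 : ℝ) < s.len := by
      have : 1 ≤ s.len := by
        have := two_mul_size_le_len hs
        have : 1 ≤ s.size := List.length_pos_of_ne_nil hs0
        omega
      exact_mod_cast this
    set E : ℝ := bigK d ^ (5 * k + s.index - 1) * catProd s with hE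
    have hE0 : 0 ≤ E := mul_nonneg (pow_nonneg hK0 _) (catProd_nonneg s)
    -- positive splittings
    have hS : ∑ o : SameIdx s, absCoeff (s.posSplitAt o) k ≤ (s.len : ℝ) * E := by
      refine (sum_sameIdx_le _ (fun i g => bigK d ^ (5 * k + s.index - 1) *
        (catProd (s.take i) * ((catalan ((s.get i).length - g - 1) * catalan (g - 1) : ℕ) : ℝ) *
          catProd (s.drop (i + 1)))) (fun i g => ?_) (fun o => ?_)).trans ?_
      · exact mul_nonneg (pow_nonneg hK0 _)
          (mul_nonneg (mul_nonneg (catProd_nonneg _) (Nat.cast_nonneg _)) (catProd_nonneg _))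
      · have hlt : (s.posSplitAt o).index < n := hsn ▸ LoopSeq.index_posSplitAt_lt hsne o
        refine (ihn _ hlt _ rfl (hs.posSplitAt o)).trans ?_
        refine mul_le_mul (pow_le_pow_right₀ hK1 (by omega)) (catProd_posSplitAt_le hsne o) (catProd_nonneg _)
          (pow_nonneg hK0 _)
      · rw [← sum_length_get, Finset.sum_mul]
        refine Finset.sum_le_sum fun i _ => ?_
        refine mul_le_mul_of_nonneg_left ?_ (Nat.cast_nonneg _)
        rw [← Finset.mul_sum, hE]
        exact mul_le_mul_of_nonneg_left (sum_Ico_catProd_le s i) (pow_nonneg hK0 _)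
    -- negative splittings
    have hI : ∑ o : InvIdx s, absCoeff (s.negSplitAt o) k ≤ (s.len : ℝ) * E := by
      refine (sum_invIdx_le _ (fun i g => bigK d ^ (5 * k + s.index - 1) *
        (catProd (s.take i) * ((catalan ((s.get i).length - g - 1) * catalan (g - 1) : ℕ) : ℝ) *
          catProd (s.drop (i + 1)))) (fun i g => ?_) (fun o => ?_)).trans ?_
      · exact mul_nonneg (pow_nonneg hK0 _)
          (mul_nonneg (mul_nonneg (catProd_nonneg _) (Nat.cast_nonneg _)) (catProd_nonneg _))
      · have hlt : (s.negSplitAt o).index < n := hsn ▸ LoopSeq.index_negSplitAt_lt hsne o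
        refine (ihn _ hlt _ rfl (hs.negSplitAt o)).trans ?_
        refine mul_le_mul (pow_le_pow_right₀ hK1 (by omega)) (catProd_negSplitAt_le hsne o) (catProd_nonneg _)
          (pow_nonneg hK0 _)
      · rw [← sum_length_get, Finset.sum_mul]
        refine Finset.sum_le_sum fun i _ => ?_
        refine mul_le_mul_of_nonneg_left ?_ (Nat.cast_nonneg _)
        rw [← Finset.mul_sum, hE]
        exact mul_le_mul_of_nonneg_left (sum_Ico_catProd_le s i) (pow_nonneg hK0 _)
    -- deformations (only for `k ≥ 1`)
    have hD : ∀ (op : (o : DeformIdx s) → LoopSeq d),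
        (∀ o : DeformIdx s, IsLoopSeq (op o)) →
        (∀ o : DeformIdx s, ∃ w : Word d, w.length ≤ (s.get o.1).length + 4 ∧ op o = s.replaceAt o.1 [w]) →
        1 ≤ k → ∑ o : DeformIdx s, absCoeff (op o) (k - 1) ≤ (s.len : ℝ) * (((2 * (d - 1) : ℕ) : ℝ) * (256 * E)) := by
      intro op hop hw hk
      refine (sum_deformIdx_le _ (fun _ => 256 * E) (fun _ => by positivity) (fun o => ?_)).trans ?_
      · obtain ⟨w, hwl, hwe⟩ := hw o
        refine (ihk (k - 1) (by omega) (op o) (hop o)).trans ?_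
        have hidx : (op o).index ≤ s.index + 4 := by rw [hwe]; exact index_replaceAt_one_le_four hsne o.1 w hwl
        have hcat : catProd (op o) ≤ 256 * catProd s := by rw [hwe]; exact catProd_replaceAt_one_le hsne o.1 w hwl
        calc bigK d ^ (5 * (k - 1) + (op o).index) * catProd (op o)
            ≤ bigK d ^ (5 * k + s.index - 1) * (256 * catProd s) :=
              mul_le_mul (pow_le_pow_right₀ hK1 (by omega)) hcat (catProd_nonneg _) (pow_nonneg hK0 _)
          _ = 256 * E := by rw [hE]; ring
      · rw [← sum_length_get, Finset.sum_mul]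
        exact le_of_eq (Finset.sum_congr rfl fun i _ => by ring)
    have hDpos : 1 ≤ k → ∑ o : DeformIdx s, absCoeff (s.posDeformAt o) (k - 1) ≤
        (s.len : ℝ) * (((2 * (d - 1) : ℕ) : ℝ) * (256 * E)) :=
      hD (fun o => s.posDeformAt o) (fun o => hs.posDeformAt o)
        (fun o => ⟨_, Word.length_posDeform_le (s.get o.1) o.2.1 o.2.2.1, rfl⟩)
    have hDneg : 1 ≤ k → ∑ o : DeformIdx s, absCoeff (s.negDeformAt o) (k - 1) ≤
        (s.len : ℝ) * (((2 * (d - 1) : ℕ) : ℝ) * (256 * E)) :=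
      hD (fun o => s.negDeformAt o) (fun o => hs.negDeformAt o)
        (fun o => ⟨_, Word.length_negDeform_le (s.get o.1) o.2.1 o.2.2.1, rfl⟩)
    -- assembly
    have hbr : (∑ o : SameIdx s, absCoeff (s.posSplitAt o) k) + (∑ o : InvIdx s, absCoeff (s.negSplitAt o) k)
        + (if 1 ≤ k then
            (∑ o : DeformIdx s, absCoeff (s.posDeformAt o) (k - 1)) + ∑ o : DeformIdx s, absCoeff (s.negDeformAt o) (k - 1)
          else 0) ≤ (s.len : ℝ) * (E * bigK d) := by
      have hsum : (s.len : ℝ) * E + (s.len : ℝ) * E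
          + ((s.len : ℝ) * (((2 * (d - 1) : ℕ) : ℝ) * (256 * E)) + (s.len : ℝ) * (((2 * (d - 1) : ℕ) : ℝ) * (256 * E)))
          = (s.len : ℝ) * (E * bigK d) := by
        rw [bigK]; push_cast; ring
      by_cases hk : 1 ≤ k
      · rw [if_pos hk, ← hsum]
        exact add_le_add (add_le_add hS hI) (add_le_add (hDpos hk) (hDneg hk))
      · rw [if_neg hk, add_zero, ← hsum]
        refine (add_le_add hS hI).trans (le_add_of_nonneg_right ?_)
        positivity
    calc absCoeff s k ≤ _ := absCoeff_le_rec hs0 k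
      _ ≤ (1 / (s.len : ℝ)) * ((s.len : ℝ) * (E * bigK d)) := mul_le_mul_of_nonneg_left hbr (by positivity)
      _ = E * bigK d := by field_simp
      _ = bigK d ^ (5 * k + s.index) * catProd s := by
          have hexp : bigK d ^ (5 * k + s.index) = bigK d ^ (5 * k + s.index - 1) * bigK d := by
            rw [← pow_succ]; congr 1; omega
          rw [hE, hexp]
          ring
  exact fun s hs => main _ s rfl hs

end CoeffCatalanBoundProof

open CoeffCatalanBoundProof in
/-- ★ **Chatterjee 2019, Lemma 10.1 — the named fact `CoeffCatalanBound` DISCHARGED** (Catalan bound on the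
strong-coupling coefficients): with `K = 2 + 1024(d−1)`, for every genuine loop sequence `s` and every `k`,
`|a_k(s)| ≤ K^{5k+ι(s)} C_{|l₁|−1} ⋯ C_{|lₙ|−1}`.  The tree's `a_k(s)` is the trajectory sum `∑_{X∈𝒳ₖ(s)} v(X)` (Cor. 3.5),
so the printed nested induction of Lemma 10.1 is run — as the source does for the numbers `b_k(s)` in Lemma 11.2 — on the
symmetrized (first-move) recursion, for the absolute sums `c_k(s) = ∑_{X∈𝒳ₖ(s)} |v(X)| ≥ |a_k(s)|`.
[cite: Chatterjee2019LargeN, Lemma 10.1; Lemma 11.2] -/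
theorem CoeffCatalanBound_holds : ∀ d : ℕ, CoeffCatalanBound d := by
  intro d _
  refine ⟨bigK d, one_le_bigK d, fun s hs k => ?_⟩
  have h := (abs_coeffA_le_absCoeff s k).trans (absCoeff_le_pow k s hs)
  simpa only [catProd] using h

/-! ### §G Theorem 11.1 (absolute convergence of the sum over trajectories) and the first step of the proof of
Theorem 10.3 (absolute convergence of `∑ a_k(s) β^k`), both HYPOTHESIS-FREE from the Catalan bound -/

namespace CoeffCatalanBoundProof

/-- For `|β| ≤ 1/(2K⁵)`: `c_k(s) |β|^k ≤ K^{ι(s)} Π(s) 2^{−k}` («Lemma 11.2 shows that the last expression converges if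
`|β|` is small enough», proof of Theorem 11.1). [cite: Chatterjee2019LargeN, Lemma 11.2, proof of Theorem 11.1] -/
theorem absCoeff_mul_pow_le {β : ℝ} (hβ : |β| ≤ 1 / (2 * bigK d ^ 5)) {s : LoopSeq d} (hs : IsLoopSeq s) (k : ℕ) :
    absCoeff s k * |β| ^ k ≤ bigK d ^ s.index * catProd s * (1 / 2) ^ k := by
  have hK1 : 1 ≤ bigK d := one_le_bigK d
  have hK0 : 0 < bigK d := by linarith
  have h5 : 0 < bigK d ^ 5 := by positivity
  have h2 : bigK d ^ 5 * |β| ≤ 1 / 2 := by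
    calc bigK d ^ 5 * |β| ≤ bigK d ^ 5 * (1 / (2 * bigK d ^ 5)) := mul_le_mul_of_nonneg_left hβ h5.le
      _ = 1 / 2 := by field_simp
  calc absCoeff s k * |β| ^ k ≤ bigK d ^ (5 * k + s.index) * catProd s * |β| ^ k :=
        mul_le_mul_of_nonneg_right (absCoeff_le_pow k s hs) (pow_nonneg (abs_nonneg _) _)
    _ = bigK d ^ s.index * catProd s * (bigK d ^ 5 * |β|) ^ k := by ring
    _ ≤ bigK d ^ s.index * catProd s * (1 / 2) ^ k :=
        mul_le_mul_of_nonneg_left (pow_le_pow_left₀ (by positivity) h2 k)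
          (mul_nonneg (pow_nonneg hK0.le _) (catProd_nonneg _))

/-- `S_{β,k}(s) = ∑_{X∈𝒳ₖ(s)} |w_β(X)| = c_k(s) |β|^k` (the tree's form of Lemma 11.4: `w_β(X) = v(X) β^{#deformations}`).
[cite: Chatterjee2019LargeN, Lemma 11.4] -/
theorem tsum_abs_weight_trajectoryWith (s : LoopSeq d) (β : ℝ) (k : ℕ) :
    ∑' X : TrajectoryWith s k, |X.1.weight β| = absCoeff s k * |β| ^ k := by
  rw [absCoeff, ← tsum_mul_right]
  refine tsum_congr fun X => ?_
  rw [Trajectory.weight_eq_vweight_mul_pow, X.2, abs_mul, abs_pow]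

end CoeffCatalanBoundProof

open CoeffCatalanBoundProof in
/-- ★ **Chatterjee 2019, Theorem 11.1 (absolute convergence of the sum over trajectories), PROVED, hypothesis-free.**
«There exists `β₂(d) > 0` such that if `|β| ≤ β₂(d)`, then for any non-null loop sequence `s`, `∑_{X∈𝒳(s)} |w_β(X)| < ∞`.»
Rendering in the vocabulary of Theorem 3.1 (`GaugeStringDuality`, whose first conjunct this is): for `|β| ≤ β₂ := 1/(2K⁵)`,
`K = 2 + 1024(d−1)`, and every genuine loop sequence `s` (the null one included), `X ↦ w_β(X)` is summable over `𝒳(s)`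
(`Trajectory s`; summable = absolutely summable in `ℝ`).  Printed proof followed: `𝒳(s) = ⨆ₖ 𝒳ₖ(s)` with `𝒳ₖ(s)` finite
(Lemma 11.3, tree `finite_trajectoryWith`), `∑_{𝒳ₖ(s)} |w_β| = c_k(s)|β|^k` (Lemma 11.4) and the Catalan bound of
Lemma 11.2 (`absCoeff_le_pow`) make `∑ₖ` a convergent geometric series.  Combined with `hasSum_coeffA_mul_pow` (sibling
`RealAnalyticity`) it gives `∑_{X∈𝒳(s)} w_β(X) = ∑ₖ a_k(s) β^k` for `|β| ≤ β₂`, the reorganisation step of §12.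
[cite: Chatterjee2019LargeN, Theorem 11.1 (with Lemmas 11.2–11.4); §12 (last display)] -/
theorem trajectoryWeight_summable : ∃ β₂ : ℝ, 0 < β₂ ∧ ∀ β : ℝ, |β| ≤ β₂ →
    ∀ s : LoopSeq d, IsLoopSeq s → Summable (fun X : Trajectory s => X.weight β) := by
  have hK0 : 0 < bigK d := lt_of_lt_of_le one_pos (one_le_bigK d)
  refine ⟨1 / (2 * bigK d ^ 5), by positivity, fun β hβ s hs => ?_⟩
  refine summable_abs_iff.mp ?_
  let e := Equiv.sigmaFiberEquiv fun X : Trajectory s => X.numDeform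
  refine (e.summable_iff (f := fun X : Trajectory s => |X.weight β|)).mp ?_
  refine (summable_sigma_of_nonneg fun _ => abs_nonneg _).2 ⟨fun k => ?_, ?_⟩
  · haveI : Fintype (TrajectoryWith s k) := @Fintype.ofFinite _ (finite_trajectoryWith s k)
    exact (hasSum_fintype _).summable
  · refine Summable.of_nonneg_of_le (fun k => tsum_nonneg fun _ => abs_nonneg _) (fun k => ?_)
      ((summable_geometric_of_lt_one (by norm_num) (by norm_num : (1 / 2 : ℝ) < 1)).mul_left
        (bigK d ^ s.index * catProd s))
    calc ∑' X : TrajectoryWith s k, |X.1.weight β| = absCoeff s k * |β| ^ k := tsum_abs_weight_trajectoryWith s β k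
      _ ≤ bigK d ^ s.index * catProd s * (1 / 2) ^ k := absCoeff_mul_pow_le hβ hs k

open CoeffCatalanBoundProof in
/-- **Chatterjee 2019, Theorem 10.3 — the first step of its proof, PROVED, hypothesis-free.** «Let `K = K(d)` be as in
Lemma 10.1. If `|β| < K^{−5}`, then by Lemma 10.1, the series `ψ_β(s) := ∑_{k=0}^∞ a_k(s) β^k` converges absolutely for
any `s`.»  Rendering: for `|β| ≤ β₁ := 1/(2K⁵)` and every genuine loop sequence `s`, `k ↦ |a_k(s) β^k|` is summable.
(The remainder of Theorem 10.3 — `ψ_β = φ_β` — needs Theorem 9.2 / Theorem 8.1 and is not asserted here.)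
[cite: Chatterjee2019LargeN, Theorem 10.3 (first sentence of the proof); Lemma 10.1] -/
theorem coeffA_mul_pow_summable_abs : ∃ β₁ : ℝ, 0 < β₁ ∧ ∀ β : ℝ, |β| ≤ β₁ →
    ∀ s : LoopSeq d, IsLoopSeq s → Summable (fun k : ℕ => |coeffA s k * β ^ k|) := by
  have hK0 : 0 < bigK d := lt_of_lt_of_le one_pos (one_le_bigK d)
  refine ⟨1 / (2 * bigK d ^ 5), by positivity, fun β hβ s hs => ?_⟩
  refine Summable.of_nonneg_of_le (fun k => abs_nonneg _) (fun k => ?_)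
    ((summable_geometric_of_lt_one (by norm_num) (by norm_num : (1 / 2 : ℝ) < 1)).mul_left
      (bigK d ^ s.index * catProd s))
  calc |coeffA s k * β ^ k| = |coeffA s k| * |β| ^ k := by rw [abs_mul, abs_pow]
    _ ≤ absCoeff s k * |β| ^ k := mul_le_mul_of_nonneg_right (abs_coeffA_le_absCoeff s k) (pow_nonneg (abs_nonneg _) _)
    _ ≤ bigK d ^ s.index * catProd s * (1 / 2) ^ k := absCoeff_mul_pow_le hβ hs k

end Literature.MathematicalPhysics.QuantumFieldTheory.Chatterjee2019LargeN

end
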